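import Mathlib.Analysis.InnerProductSpace.Basic
import Mathlib.Algebra.Order.Chebyshev
import Mathlib.Analysis.SpecialFunctions.Sqrt
import Mathlib.Topology.Order.Basic
import Mathlib.Topology.Order.Compact
import Literature.Geometry.Lorentzian.StationaryVacuumRigidity
import Literature.Geometry.Lorentzian.CompleteStationaryVacuumFlat
import Literature.Geometry.Manifold.CompleteFlow
import HarnessLib

/-!
# Anderson's rigidity theorem (Anderson 2000, Thm. 0.1): the elementary layer of the printed proof

Sibling proof file of `StationaryVacuumRigidity.lean` (named fact
`Literature.Geometry.Lorentzian.Anderson2000_stationaryVacuum_flat`, [Anderson2000, Thm. 0.1]: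
"a geodesically complete, chronological, stationary vacuum space-time is flat"). The discharge
`Anderson2000_stationaryVacuum_flat_holds` is NOT here yet: the printed proof (Anderson, AHP 1
(2000) 977–994 = arXiv:gr-qc/0001091, §1–§2) rests on layers of Riemannian geometry and geometric
analysis absent from Mathlib and from `Literature/` — the orbit-space reduction `M → S = M/ℝ` of a
chronological stationary space-time and the reduced vacuum system (1.3)–(1.6), the conformal
change `ḡ = u² g_S` and the harmonic Ernst map `E = (φ, u²) : (S, ḡ) → H²(−1)` (§2, (2.1)–(2.11)),
the Eells–Sampson/Eells–Lemaire Bochner formula (2.13), an Omori–Yau-type maximum principle on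
complete manifolds of bounded curvature, and Cheeger–Gromov convergence / Fukaya collapse theory
with elliptic regularity (Lemmas 1.3–1.5). What IS formalised here, verbatim and in the printed
order, is the elementary (pointwise-algebraic and real-analysis) content of **Step I of §2**, into
which those inputs are plugged:

* `Anderson2000.sum_gram_two_minors_eq`, `Anderson2000.sum_gram_two_minors_nonneg`: for a frame
  `w i = E_*(e_i)` the double sum `Σᵢⱼ (⟨wᵢ,wᵢ⟩⟨wⱼ,wⱼ⟩ − ⟨wᵢ,wⱼ⟩²)` — which is
  `−Σᵢⱼ (E*R₋₁)(eᵢ,eⱼ,eⱼ,eᵢ)` for a target of constant curvature `−1` — equals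
  `(Σᵢ ⟨wᵢ,wᵢ⟩)² − Σᵢⱼ ⟨wᵢ,wⱼ⟩²` and is `≥ 0` (Cauchy–Schwarz), Anderson (2.15);
* `Anderson2000.claim_2_14`, `Anderson2000.claim_2_15`, `Anderson2000.energy_eq_trace`:
  with `P = E*(g₋₁)` the Gram matrix of the frame, `r̄ = ½ P` ((2.10)) and `s̄ = tr r̄`, one has
  `⟨r̄, E*(g₋₁)⟩ = 2|r̄|²` (2.14), `−Σ (E*R₋₁)(eᵢ,eⱼ,eⱼ,eᵢ) = 4(s̄² − |r̄|²) ≥ 0` (2.15) and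
  `e(E) = ½ Σ ⟨wᵢ,wᵢ⟩ = s̄` (2.11);
* `Anderson2000.trace_sq_le_card_mul_normSq`: `(tr A)² ≤ n · |A|²` for an `n × n` real array
  (so `s̄² ≤ 3 |r̄|²` on the `3`-manifold `S`: "`|r̄|²(xᵢ) → 0` … forces `e(E)(xᵢ) = s̄(xᵢ) → 0`");
* `Anderson2000.eq_zero_of_isMaximizingSeq_tendsto_zero`: a non-negative function bounded above
  whose values along a maximizing sequence tend to `0` vanishes identically ("since `xᵢ` is a
  maximizing sequence, this is only possible if `e(E) ≡ 0`");
* `Anderson2000.stepI_energy_density_eq_zero`: **the last paragraph of Step I** assembled — from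
  the Bochner identity in the substituted form `Δ̄e = |∇̄DE|² + 2|r̄|² + 4(s̄² − |r̄|²)` with
  `e = s̄`, the pointwise facts above, boundedness of `e` and a maximizing sequence `xᵢ` with
  `Δ̄e(xᵢ) ≤ εᵢ → 0`, conclude `e ≡ 0` (whence `E` is constant, `u = const`, `φ = const`, and
  `(M, g)` is flat — the geometric translation is again outside this file);
* **Step II, pointwise** (`Anderson2000.claim_2_21`, `.middle_term_eq`, `.claim_2_23`,
  `.claim_2_24`, `.h_eq_zero_iff`): the chain of substitutions (2.20) → (2.24) at a point of `S`,
  with the calculus rules (product and chain rule for `Δ`, `d(u⁻²h)`, the conformal relation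
  (2.17)) and the field equation (1.4)+(1.7) as instantiated hypotheses over the inner product
  space `(TₓS, g_S)`: `Δh − 3⟨dlog u, dh⟩ = u⁴|∇̄DE|² + 2u⁴(s̄² − |r̄|²) ≥ 0`, and `h = 0 ⇔
  du = 0 ∧ dφ = 0` (the reading of (2.25)).
* **Lemma 1.5, point selection** (`Anderson2000.exists_point_selection`,
  `Anderson2000.exists_blowup_points`): the "point-picking" step (1.19)–(1.21) of the blow-up
  argument, for a continuous `f ≥ 0` (`= |r|`) on a metric space with compact closed balls
  (`= (S, g_S)` complete): almost-maximal points `yᵢ` with `f(yᵢ) → ∞`, rescaled distance to the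
  boundary `→ ∞`, and `f ≤ 4 f(yᵢ)` on the half-radius ball; the Cheeger–Gromov / collapse limit
  (Lemmas 1.3–1.4) is not formalised.
* **§0 set-up in the tree's vocabulary** (`Anderson2000.velocity_of_isMIntegralCurve`,
  `.isFutureTimelikeCurveOn_of_isMIntegralCurve`, `.injective_of_isMIntegralCurve`,
  `.exists_free_globalFlow`): under `𝓢.IsStationaryKilling X₀ univ` the integral curves of `X₀`
  are future-directed timelike curves; the chronology condition makes every orbit an injective
  line; and by `Literature.Geometry.Manifold.exists_contMDiff_globalFlow_of_complete` the complete
  field `X₀` generates a smooth global flow `θ : ℝ × M → M` (Anderson's "smooth 1-parameter group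
  `G ≈ ℝ` … whose orbits are time-like curves"), acting freely. That the flow acts by isometries,
  and that the orbit space `S = M/ℝ` is a smooth Hausdorff `3`-manifold (chronology, [Ha]) with the
  quotient metric `g_S`, are NOT formalised (no such theory in the tree).
* **Duplicate vendoring recorded** (`Anderson2000.stationaryVacuum_flat_iff_completeStationaryVacuumFlat`,
  `Iff.rfl`): the named fact `Anderson2000_completeStationaryVacuumFlat` of
  `CompleteStationaryVacuumFlat.lean` (landed 35 minutes after `StationaryVacuumRigidity.lean`, from
  a different cite item) is syntactically the same proposition as
  `Anderson2000_stationaryVacuum_flat`; the bridge makes a future discharge of either close both.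

Nothing here introduces a definition or a named fact (D-0026): all statements are closed lemmas over
Mathlib's real inner product spaces, finite sums and filters.

## References

* [Anderson2000] M. T. Anderson, *On stationary vacuum solutions to the Einstein equations*,
  Ann. Henri Poincaré 1 (2000) 977–994, arXiv:gr-qc/0001091: Thm. 0.1; §2, Step I, (2.10)–(2.16)
  and the paragraph following (2.16).
* J. Eells, L. Lemaire, *A report on harmonic maps*, Bull. LMS 10 (1978), (3.12) (the Bochner
  formula quoted as (2.13)).
-/

noncomputable section

open Finset Filter
open scoped RealInnerProductSpace Topology BigOperators

namespace Literature.Geometry.Lorentzian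

namespace Anderson2000

/-! ### (2.15): the curvature term of the Bochner formula for a target of curvature `−1` -/

section Gram

variable {W : Type*} [NormedAddCommGroup W] [InnerProductSpace ℝ W] {n : ℕ}

/-- **Anderson (2.15), algebraic identity.** For vectors `w₁, …, wₙ` of a real inner product space
(the images `E_*(eᵢ)` of an orthonormal frame under the differential of the Ernst map, the target
`H²(−1)` having constant curvature `−1`, so that `−(E*R₋₁)(eᵢ,eⱼ,eⱼ,eᵢ) = ⟨wᵢ,wᵢ⟩⟨wⱼ,wⱼ⟩ − ⟨wᵢ,wⱼ⟩²`):
`Σᵢⱼ (⟨wᵢ,wᵢ⟩⟨wⱼ,wⱼ⟩ − ⟨wᵢ,wⱼ⟩²) = (Σᵢ ⟨wᵢ,wᵢ⟩)² − Σᵢⱼ ⟨wᵢ,wⱼ⟩²`, i.e. `(tr P)² − |P|²` for the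
Gram matrix `P = E*(g₋₁)`. [cite: Anderson2000, §2 (2.15)] -/
theorem sum_gram_two_minors_eq (w : Fin n → W) :
    ∑ i, ∑ j, (inner ℝ (w i) (w i) * inner ℝ (w j) (w j) - inner ℝ (w i) (w j) ^ 2) =
      (∑ i, inner ℝ (w i) (w i)) ^ 2 - ∑ i, ∑ j, inner ℝ (w i) (w j) ^ 2 := by
  simp only [Finset.sum_sub_distrib, sq, Finset.sum_mul_sum]

/-- **Anderson (2.15), sign.** Each `2 × 2` Gram minor `⟨wᵢ,wᵢ⟩⟨wⱼ,wⱼ⟩ − ⟨wᵢ,wⱼ⟩²` is non-negative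
(Cauchy–Schwarz), hence so is the double sum: the curvature term of the Bochner formula (2.13) for
a non-positively curved target is `≥ 0`. [cite: Anderson2000, §2 (2.15)] -/
theorem sum_gram_two_minors_nonneg (w : Fin n → W) :
    0 ≤ ∑ i, ∑ j, (inner ℝ (w i) (w i) * inner ℝ (w j) (w j) - inner ℝ (w i) (w j) ^ 2) :=
  Finset.sum_nonneg fun i _ ↦ Finset.sum_nonneg fun j _ ↦
    sub_nonneg.2 (by simpa only [sq] using real_inner_mul_inner_self_le (w i) (w j))

/-- **Anderson (2.11).** The energy density `e(E) = ½ |E_*|² = ½ Σᵢ ⟨E_* eᵢ, E_* eᵢ⟩` equals the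
scalar curvature `s̄ = tr r̄` once `r̄ = ½ E*(g₋₁)` ((2.10), from the field equation (2.3)):
with `P i j = ⟨wᵢ,wⱼ⟩` and `r̄ = ½ P`, `½ Σᵢ ⟨wᵢ,wᵢ⟩ = Σᵢ r̄ᵢᵢ`. [cite: Anderson2000, §2 (2.10)–(2.11)] -/
theorem energy_eq_trace (w : Fin n → W) {rbar : Fin n → Fin n → ℝ}
    (h210 : ∀ i j, rbar i j = inner ℝ (w i) (w j) / 2) :
    (∑ i, inner ℝ (w i) (w i)) / 2 = ∑ i, rbar i i := by
  simp only [h210, Finset.sum_div]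

/-- **Anderson (2.14).** With `r̄ = ½ E*(g₋₁)` ((2.10)), the middle term of the Bochner formula
(2.13) is `⟨r̄, E*(g₋₁)⟩ = Σᵢⱼ r̄ᵢⱼ Pᵢⱼ = 2 Σᵢⱼ r̄ᵢⱼ² = 2|r̄|²` (components in an orthonormal frame
`eᵢ` of `(S, ḡ)`, `Pᵢⱼ = ⟨E_* eᵢ, E_* eⱼ⟩`). [cite: Anderson2000, §2 (2.14)] -/
theorem claim_2_14 (w : Fin n → W) {rbar : Fin n → Fin n → ℝ}
    (h210 : ∀ i j, rbar i j = inner ℝ (w i) (w j) / 2) :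
    ∑ i, ∑ j, rbar i j * inner ℝ (w i) (w j) = 2 * ∑ i, ∑ j, rbar i j ^ 2 := by
  simp only [h210, Finset.mul_sum]
  refine Finset.sum_congr rfl fun i _ ↦ Finset.sum_congr rfl fun j _ ↦ ?_
  ring

/-- **Anderson (2.15).** With `r̄ = ½ E*(g₋₁)` and `s̄ = tr r̄`, the curvature term of the Bochner
formula is `−Σᵢⱼ (E*R₋₁)(eᵢ,eⱼ,eⱼ,eᵢ) = Σᵢⱼ (⟨wᵢ,wᵢ⟩⟨wⱼ,wⱼ⟩ − ⟨wᵢ,wⱼ⟩²) = 4 (s̄² − |r̄|²)`, and it is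
`≥ 0` (`sum_gram_two_minors_nonneg`). [cite: Anderson2000, §2 (2.15)] -/
theorem claim_2_15 (w : Fin n → W) {rbar : Fin n → Fin n → ℝ}
    (h210 : ∀ i j, rbar i j = inner ℝ (w i) (w j) / 2) :
    ∑ i, ∑ j, (inner ℝ (w i) (w i) * inner ℝ (w j) (w j) - inner ℝ (w i) (w j) ^ 2) =
        4 * ((∑ i, rbar i i) ^ 2 - ∑ i, ∑ j, rbar i j ^ 2) ∧
      0 ≤ (∑ i, rbar i i) ^ 2 - ∑ i, ∑ j, rbar i j ^ 2 := by
  have hval : ∑ i, ∑ j, (inner ℝ (w i) (w i) * inner ℝ (w j) (w j) - inner ℝ (w i) (w j) ^ 2) =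
      4 * ((∑ i, rbar i i) ^ 2 - ∑ i, ∑ j, rbar i j ^ 2) := by
    rw [sum_gram_two_minors_eq]
    have h1 : ∑ i, inner ℝ (w i) (w i) = 2 * ∑ i, rbar i i := by
      rw [Finset.mul_sum]
      exact Finset.sum_congr rfl fun i _ ↦ by rw [h210]; ring
    have h2 : ∑ i, ∑ j, inner ℝ (w i) (w j) ^ 2 = 4 * ∑ i, ∑ j, rbar i j ^ 2 := by
      rw [Finset.mul_sum]
      refine Finset.sum_congr rfl fun i _ ↦ ?_
      rw [Finset.mul_sum]
      exact Finset.sum_congr rfl fun j _ ↦ by rw [h210]; ring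
    rw [h1, h2]
    ring
  refine ⟨hval, ?_⟩
  have h := sum_gram_two_minors_nonneg w
  rw [hval] at h
  linarith

end Gram

/-! ### `s̄² ≤ 3 |r̄|²`: from `|r̄|²(xᵢ) → 0` to `s̄(xᵢ) → 0` -/

/-- **Trace against Hilbert–Schmidt norm.** For an `n × n` real array `A`, `(Σᵢ Aᵢᵢ)² ≤ n Σᵢⱼ Aᵢⱼ²`
(Cauchy–Schwarz on the diagonal, then the diagonal is part of the full sum). On the `3`-manifold
`(S, ḡ)` this is `s̄² ≤ 3 |r̄|²`, the step "`|r̄|²(xᵢ) ≤ εᵢ → 0` … forces `e(E)(xᵢ) = s̄(xᵢ) → 0`" of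
Step I. [cite: Anderson2000, §2, Step I (paragraph after (2.16))] -/
theorem trace_sq_le_card_mul_normSq {n : ℕ} (A : Fin n → Fin n → ℝ) :
    (∑ i, A i i) ^ 2 ≤ n * ∑ i, ∑ j, A i j ^ 2 := by
  have h1 : (∑ i, A i i) ^ 2 ≤ n * ∑ i, A i i ^ 2 := by
    simpa using sq_sum_le_card_mul_sum_sq (s := (Finset.univ : Finset (Fin n))) (f := fun i ↦ A i i)
  have h2 : ∑ i, A i i ^ 2 ≤ ∑ i, ∑ j, A i j ^ 2 :=
    Finset.sum_le_sum fun i _ ↦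
      Finset.single_le_sum (f := fun j ↦ A i j ^ 2) (fun j _ ↦ sq_nonneg (A i j)) (Finset.mem_univ i)
  have hn : (0 : ℝ) ≤ n := Nat.cast_nonneg n
  nlinarith

/-! ### The maximizing-sequence argument -/

/-- **Maximizing sequences.** If `f ≥ 0` is bounded above and its values along a maximizing
sequence (`f (x i) → sup f`) tend to `0`, then `f ≡ 0`: "Since `xᵢ` is a maximizing sequence, this
is only possible if `e(E) ≡ 0`". [cite: Anderson2000, §2, Step I (paragraph after (2.16))] -/
theorem eq_zero_of_isMaximizingSeq_tendsto_zero {S : Type*} {f : S → ℝ} (hf0 : ∀ y, 0 ≤ f y)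
    (hbdd : BddAbove (Set.range f)) {x : ℕ → S}
    (hmax : Tendsto (fun i ↦ f (x i)) atTop (𝓝 (⨆ y, f y)))
    (hlim : Tendsto (fun i ↦ f (x i)) atTop (𝓝 0)) (y : S) : f y = 0 := by
  have hsup : (⨆ y, f y) = 0 := tendsto_nhds_unique hmax hlim
  exact le_antisymm (hsup ▸ le_ciSup hbdd y) (hf0 y)

/-- **Anderson 2000, §2, Step I — the endgame, assembled.** Abstract form of the last paragraph of
Step I of the proof of Thm. 0.1. On the point set `S` of the (complete, `|r̄| ≤ 1`) conformal orbit
space `(S, ḡ)` let `e = e(E)` be the energy density of the Ernst map, `rn = |r̄|²`, `hs = |∇̄DE|²`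
and `lap = Δ̄ e(E)`, and assume, pointwise:
* `hbochner`: the Bochner formula (2.13) with the claims (2.14), (2.15) substituted and `s̄ = e(E)`
  ((2.11)): `Δ̄e = |∇̄DE|² + 2|r̄|² + 4(e² − |r̄|²)`;
* `hhs`: `|∇̄DE|² ≥ 0`; `h215`: `e² − |r̄|² ≥ 0` ((2.15), `claim_2_15`); `htr`: `e² = s̄² ≤ 3|r̄|²`
  (`trace_sq_le_card_mul_normSq`, `dim S = 3`); `he0`: `e ≥ 0`;
* `hbdd`: `e` is bounded above ("since (2.12) holds, (2.11) implies that `e(E)` is uniformly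
  bounded above");
* `hmax`, `hlap`, `hε`: a maximizing sequence `xᵢ` for `e` ((2.16)) along which `Δ̄e(xᵢ) ≤ εᵢ`,
  `εᵢ → 0` ("it follows from elementary properties of the Laplacian" — the Omori–Yau maximum
  principle on the complete manifold `(S, ḡ)` of bounded curvature).
Then `e(E) ≡ 0` ("i.e. `E` is a constant map. This means that `u = const > 0`, `φ = const`, and
hence `(M, g)` is flat"). The analytic inputs (Bochner identity, Omori–Yau, and the geometric
set-up producing `e, r̄`) are hypotheses here; only the printed deduction is certified.
[cite: Anderson2000, §2, Step I, (2.13)–(2.16) ff.] -/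
theorem stepI_energy_density_eq_zero {S : Type*} {e rn hs lap : S → ℝ}
    (hbochner : ∀ y, lap y = hs y + 2 * rn y + 4 * (e y ^ 2 - rn y))
    (hhs : ∀ y, 0 ≤ hs y) (h215 : ∀ y, rn y ≤ e y ^ 2) (htr : ∀ y, e y ^ 2 ≤ 3 * rn y)
    (he0 : ∀ y, 0 ≤ e y) (hbdd : BddAbove (Set.range e))
    {x : ℕ → S} (hmax : Tendsto (fun i ↦ e (x i)) atTop (𝓝 (⨆ y, e y)))
    {ε : ℕ → ℝ} (hε : Tendsto ε atTop (𝓝 0)) (hlap : ∀ i, lap (x i) ≤ ε i) (y : S) :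
    e y = 0 := by
  -- `Δ̄e ≥ 2|r̄|²`, hence `|r̄|²(xᵢ) ≤ εᵢ / 2 → 0`
  have hrn_le : ∀ i, rn (x i) ≤ ε i / 2 := fun i ↦ by
    have hb := hbochner (x i)
    have := hhs (x i)
    have := h215 (x i)
    have := hlap i
    linarith
  -- `0 ≤ e(xᵢ)² ≤ 3|r̄|²(xᵢ) ≤ 3εᵢ/2 → 0`
  have hsq : Tendsto (fun i ↦ e (x i) ^ 2) atTop (𝓝 0) := by
    have hg : Tendsto (fun i ↦ 3 * (ε i / 2)) atTop (𝓝 0) := by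
      simpa using (hε.div_const 2).const_mul (3 : ℝ)
    refine squeeze_zero (g := fun i ↦ 3 * (ε i / 2)) (fun i ↦ sq_nonneg _) (fun i ↦ ?_) hg
    exact (htr (x i)).trans (mul_le_mul_of_nonneg_left (hrn_le i) (by norm_num))
  -- hence `e(xᵢ) = √(e(xᵢ)²) → 0`
  have he : Tendsto (fun i ↦ e (x i)) atTop (𝓝 0) := by
    have h := (Real.continuous_sqrt.tendsto 0).comp hsq
    simp only [Real.sqrt_zero] at h
    refine h.congr fun i ↦ ?_
    simp [Real.sqrt_sq (he0 (x i))]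
  exact eq_zero_of_isMaximizingSeq_tendsto_zero he0 hbdd hmax he y

/-! ### Step II: the Laplacian algebra (2.18)–(2.24), pointwise

The computation of Step II is pointwise: at a point `x ∈ S` it only involves the values at `x` of
`u`, `h`, `s̄`, of the `g_S`-Laplacians `Δu`, `Δu⁻²`, `Δh`, `Δs̄`, of the `ḡ`-Laplacian `Δ̄s̄`,
and the differentials `du`, `dh`, `dφ`, `ds̄ ∈ T*ₓS ≅ (TₓS, g_S)`, an inner product space `V`.
The calculus rules Anderson invokes (product rule `Δ(fk) = fΔk + kΔf + 2⟨df, dk⟩`, chain rule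
`Δu⁻² = −2u⁻³Δu + 6u⁻⁴|du|²`, `d(u⁻²h) = −2u⁻³h du + u⁻²dh`, and the conformal relation (2.17)
`Δs̄ = u²Δ̄s̄ − ⟨dlog u, ds̄⟩` for `ḡ = u²g_S` in dimension `3`) and the field equation (1.4) with
(1.7) (`Δu = −2u⁻³|ω|² = −½u⁻³|dφ|²`) enter as hypotheses in exactly this instantiated form; what
is certified is the printed chain of substitutions (2.20) → (2.21) → (2.22) → (2.23) → (2.24). -/

section StepII

variable {V : Type*} [NormedAddCommGroup V] [InnerProductSpace ℝ V]

omit [InnerProductSpace ℝ V] in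
/-- **Anderson (2.21).** `Δu⁻² = −2u⁻³Δu + 6u⁻⁴|du|² = u⁻⁶|dφ|² + 6u⁻⁴|du|²`, "where the last
equality uses (1.4) and (1.7)" (`Δu = −2u⁻³|ω|²`, `2ω = dφ`). Pointwise, with `U = u(x)`,
`LU = Δu(x)`, `L2 = Δu⁻²(x)`. [cite: Anderson2000, §2 (2.21)] -/
theorem claim_2_21 {U LU L2 : ℝ} {du dφ : V}
    (hchain : L2 = -2 * U⁻¹ ^ 3 * LU + 6 * U⁻¹ ^ 4 * ‖du‖ ^ 2)
    (h14 : LU = -(1 / 2) * U⁻¹ ^ 3 * ‖dφ‖ ^ 2) :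
    L2 = U⁻¹ ^ 6 * ‖dφ‖ ^ 2 + 6 * U⁻¹ ^ 4 * ‖du‖ ^ 2 := by
  rw [hchain, h14]
  ring

omit [InnerProductSpace ℝ V] in
/-- **Anderson (2.18): the middle term of (2.22)–(2.23).** With `h = 2|dlog u|² + ½u⁻⁴|dφ|²`
(`|dlog u|² = u⁻²|du|²`), the coefficient `u⁻⁴|dφ|² + 4u⁻²|du|²` produced by (2.20)–(2.22) equals
`2h`, so that "by (2.18) again, the middle term on the right above equals `−2h² = −2u⁴s̄²`"
(`s̄ = u⁻²h`). [cite: Anderson2000, §2 (2.18) and the line before (2.23)] -/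
theorem middle_term_eq {U H Sb : ℝ} {du dφ : V} (hU : U ≠ 0)
    (hh : H = 2 * (‖du‖ ^ 2 / U ^ 2) + (1 / 2) * U⁻¹ ^ 4 * ‖dφ‖ ^ 2) (hS : Sb = U⁻¹ ^ 2 * H) :
    (U⁻¹ ^ 4 * ‖dφ‖ ^ 2 + 4 * U⁻¹ ^ 2 * ‖du‖ ^ 2) * H = 2 * H ^ 2 ∧ 2 * H ^ 2 = 2 * U ^ 4 * Sb ^ 2 := by
  subst hS
  constructor
  · rw [hh]
    field_simp
    ring
  · field_simp

/-- **Anderson (2.23).** From (2.17) (`Δs̄ = u²Δ̄s̄ − ⟨dlog u, ds̄⟩`, conformal change of the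
Laplacian), (2.18) (`s̄ = u⁻²h`, `h = 2|dlog u|² + ½u⁻⁴|dφ|²`, hence
`ds̄ = −2u⁻³h du + u⁻²dh`), the product rule (2.20)
(`Δs̄ = Δ(u⁻²h) = u⁻²Δh + hΔu⁻² + 2⟨du⁻², dh⟩`, `du⁻² = −2u⁻³du`), the chain rule and field
equation (2.21): `Δh − 3⟨dlog u, dh⟩ = u⁴Δ̄s̄ − 2u⁴s̄²`. Pointwise at `x ∈ S`, in the inner product
space `V = (TₓS, g_S)`: `U = u(x) ≠ 0`, `H, Sb, LU, L2, LH, LS, LbS` the values of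
`h, s̄, Δu, Δu⁻², Δh, Δs̄, Δ̄s̄`, and `du, dh, dφ, dS` the gradients. [cite: Anderson2000, §2 (2.17)–(2.23)] -/
theorem claim_2_23 {U H Sb LU L2 LH LS LbS : ℝ} {du dh dφ dS : V} (hU : U ≠ 0)
    (hh : H = 2 * (‖du‖ ^ 2 / U ^ 2) + (1 / 2) * U⁻¹ ^ 4 * ‖dφ‖ ^ 2)
    (hS : Sb = U⁻¹ ^ 2 * H)
    (hdS : dS = (-2 * U⁻¹ ^ 3 * H) • du + (U⁻¹ ^ 2) • dh)
    (h220 : LS = U⁻¹ ^ 2 * LH + H * L2 + 2 * inner ℝ ((-2 * U⁻¹ ^ 3) • du) dh)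
    (hchain : L2 = -2 * U⁻¹ ^ 3 * LU + 6 * U⁻¹ ^ 4 * ‖du‖ ^ 2)
    (h14 : LU = -(1 / 2) * U⁻¹ ^ 3 * ‖dφ‖ ^ 2)
    (h217 : LS = U ^ 2 * LbS - inner ℝ (U⁻¹ • du) dS) :
    LH - 3 * inner ℝ (U⁻¹ • du) dh = U ^ 4 * LbS - 2 * U ^ 4 * Sb ^ 2 := by
  subst h14
  subst hchain hdS
  subst hS
  subst h217
  simp only [inner_add_right, inner_smul_left, inner_smul_right, real_inner_self_eq_norm_sq,
    RCLike.conj_to_real] at h220 ⊢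
  subst hh
  field_simp at h220
  field_simp
  linear_combination (-1 : ℝ) * h220

/-- **Anderson (2.24).** Substituting the Bochner formula (2.13) with (2.14)–(2.15),
`Δ̄s̄ = |∇̄DE|² + 2|r̄|² + 4(s̄² − |r̄|²)`, into (2.23):
`Δh − 3⟨dlog u, dh⟩ = u⁴|∇̄DE|² + 2u⁴(s̄² − |r̄|²) ≥ 0` (non-negativity from `|∇̄DE|² ≥ 0` and
(2.15)). Same pointwise conventions as `claim_2_23`; `N = |∇̄DE|²(x)`, `R = |r̄|²(x)`.
[cite: Anderson2000, §2 (2.24)] -/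
theorem claim_2_24 {U H Sb LU L2 LH LS LbS N R : ℝ} {du dh dφ dS : V} (hU : U ≠ 0)
    (hh : H = 2 * (‖du‖ ^ 2 / U ^ 2) + (1 / 2) * U⁻¹ ^ 4 * ‖dφ‖ ^ 2)
    (hS : Sb = U⁻¹ ^ 2 * H)
    (hdS : dS = (-2 * U⁻¹ ^ 3 * H) • du + (U⁻¹ ^ 2) • dh)
    (h220 : LS = U⁻¹ ^ 2 * LH + H * L2 + 2 * inner ℝ ((-2 * U⁻¹ ^ 3) • du) dh)
    (hchain : L2 = -2 * U⁻¹ ^ 3 * LU + 6 * U⁻¹ ^ 4 * ‖du‖ ^ 2)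
    (h14 : LU = -(1 / 2) * U⁻¹ ^ 3 * ‖dφ‖ ^ 2)
    (h217 : LS = U ^ 2 * LbS - inner ℝ (U⁻¹ • du) dS)
    (hbochner : LbS = N + 2 * R + 4 * (Sb ^ 2 - R)) (hN : 0 ≤ N) (h215 : R ≤ Sb ^ 2) :
    LH - 3 * inner ℝ (U⁻¹ • du) dh = U ^ 4 * N + 2 * U ^ 4 * (Sb ^ 2 - R) ∧
      0 ≤ LH - 3 * inner ℝ (U⁻¹ • du) dh := by
  have h223 := claim_2_23 hU hh hS hdS h220 hchain h14 h217
  have hval : LH - 3 * inner ℝ (U⁻¹ • du) dh = U ^ 4 * N + 2 * U ^ 4 * (Sb ^ 2 - R) := by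
    rw [h223, hbochner]
    ring
  refine ⟨hval, ?_⟩
  rw [hval]
  have hU4 : 0 ≤ U ^ 4 := by positivity
  nlinarith

omit [InnerProductSpace ℝ V] in
/-- **Anderson (2.25) ⇒ conclusion.** `h = 2|dlog u|² + ½u⁻⁴|dφ|²` is a sum of non-negative terms,
so `h(x) = 0` iff `du(x) = 0` and `dφ(x) = 0`: "The equation (2.25) [`h ≡ 0`] means that `u` is a
constant function and `ω = 0`" (on the connected `S`; `2ω = dφ`).
[cite: Anderson2000, §2 (2.25) and the last paragraph of §2] -/
theorem h_eq_zero_iff {U H : ℝ} {du dφ : V} (hU : U ≠ 0)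
    (hh : H = 2 * (‖du‖ ^ 2 / U ^ 2) + (1 / 2) * U⁻¹ ^ 4 * ‖dφ‖ ^ 2) :
    H = 0 ↔ du = 0 ∧ dφ = 0 := by
  subst hh
  have hU2 : 0 < U ^ 2 := by positivity
  have hU4 : 0 < U⁻¹ ^ 4 := by positivity
  constructor
  · intro h
    have h1 : 0 ≤ 2 * (‖du‖ ^ 2 / U ^ 2) := by positivity
    have h2 : 0 ≤ 1 / 2 * U⁻¹ ^ 4 * ‖dφ‖ ^ 2 := by positivity
    have h1' : 2 * (‖du‖ ^ 2 / U ^ 2) = 0 := by linarith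
    have h2' : 1 / 2 * U⁻¹ ^ 4 * ‖dφ‖ ^ 2 = 0 := by linarith
    have hdu : ‖du‖ ^ 2 = 0 := by
      have := div_eq_zero_iff.1 (by linarith : ‖du‖ ^ 2 / U ^ 2 = 0)
      exact this.resolve_right hU2.ne'
    have hdφ : ‖dφ‖ ^ 2 = 0 := by
      rcases mul_eq_zero.1 h2' with h3 | h3
      · exact absurd h3 (by positivity)
      · exact h3
    exact ⟨by simpa using hdu, by simpa using hdφ⟩
  · rintro ⟨rfl, rfl⟩
    simp

end StepII

/-! ### §1.3, Lemma 1.5: point selection ("point-picking") for a blow-up sequence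

The mechanism of Lemma 1.5 (a complete non-flat solution with unbounded curvature yields, in
the limit of a rescaled sequence, one with `|r| ≤ 1` and `|r|(y) > 0`) is the classical
selection of almost-maximal points (1.19)–(1.21): in the unit ball `Bᵢ = B_{xᵢ}(1)` maximise the
scale-invariant quantity `dᵢ(x)² |r|(x)`, `dᵢ = dist(·, ∂Bᵢ)`. This is pure metric geometry
and is formalised here for a continuous non-negative function `f` (Anderson: `f = |r|`) on a
metric space whose closed balls of the relevant radius are compact (Anderson: `(S, g_S)` complete,
Hopf–Rinow); `dist(x, ∂B_{x₀}(R))` is rendered as `R − dist(x₀, x)` (its value in a length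
space, and a lower bound for it in general). The passage to the limit (Lemmas 1.3–1.4:
Cheeger–Gromov convergence, collapse) is not formalised. -/

section PointSelection

open Metric

/-- **Point selection in one ball (Anderson 2000, proof of Lemma 1.5, (1.20)–(1.21)).** Let `f ≥ 0`
be continuous on the compact ball `B̄ = closedBall x₀ R`, `R > 0`, and let `y ∈ B̄` maximise
`(R − dist(x₀, ·))² f` ("choose points `yᵢ ∈ Bᵢ` realizing the maximum value of `dᵢ² · |r|`").
Then (i) `f x₀ ≤ f y`; (ii) `R² f(x₀) ≤ (R − dist(x₀,y))² f(y)` ((1.20): the maximal value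
dominates the value at the centre); (iii) "by the maximality property of `yᵢ`" ((1.21)), on the
ball of radius `(R − dist(x₀,y))/2` about `y` (which lies in `B̄`, and on which
`R − dist(x₀, ·) ≥ (R − dist(x₀,y))/2`) one has `f ≤ 4 f(y)`. [cite: Anderson2000, Lemma 1.5, (1.19)–(1.21)] -/
theorem exists_point_selection {X : Type*} [MetricSpace X] {x₀ : X} {R : ℝ} (hR : 0 < R)
    (hc : IsCompact (closedBall x₀ R)) {f : X → ℝ} (hf : ContinuousOn f (closedBall x₀ R))
    (hf0 : ∀ x ∈ closedBall x₀ R, 0 ≤ f x) :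
    ∃ y ∈ closedBall x₀ R, f x₀ ≤ f y ∧ R ^ 2 * f x₀ ≤ (R - dist x₀ y) ^ 2 * f y ∧
      ∀ x, dist x y ≤ (R - dist x₀ y) / 2 → x ∈ closedBall x₀ R ∧ f x ≤ 4 * f y := by
  set g : X → ℝ := fun x ↦ (R - dist x₀ x) ^ 2 * f x with hg
  have hgc : ContinuousOn g (closedBall x₀ R) :=
    ((continuous_const.sub (continuous_const.dist continuous_id)).pow 2).continuousOn.mul hf
  have hx₀ : x₀ ∈ closedBall x₀ R := mem_closedBall_self hR.le
  obtain ⟨y, hy, hmax⟩ := hc.exists_isMaxOn ⟨x₀, hx₀⟩ hgc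
  have hy' : dist x₀ y ≤ R := by rwa [mem_closedBall, dist_comm] at hy
  have hDy0 : 0 ≤ R - dist x₀ y := sub_nonneg.2 hy'
  have hfy : 0 ≤ f y := hf0 y hy
  have h0 : R ^ 2 * f x₀ ≤ (R - dist x₀ y) ^ 2 * f y := by
    have := hmax hx₀
    simpa [hg] using this
  refine ⟨y, hy, ?_, h0, fun x hx ↦ ?_⟩
  · -- `f x₀ ≤ f y`, since `(R - d)² ≤ R²`
    have h1 : (R - dist x₀ y) ^ 2 * f y ≤ R ^ 2 * f y :=
      mul_le_mul_of_nonneg_right (pow_le_pow_left₀ hDy0 (sub_le_self _ dist_nonneg) 2) hfy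
    exact le_of_mul_le_mul_left (h0.trans h1) (pow_pos hR 2)
  · have hxy : dist x y ≤ (R - dist x₀ y) / 2 := hx
    have hxB : x ∈ closedBall x₀ R := by
      rw [mem_closedBall]
      calc dist x x₀ ≤ dist x y + dist y x₀ := dist_triangle _ _ _
        _ ≤ (R - dist x₀ y) / 2 + dist x₀ y := by rw [dist_comm y x₀]; linarith
        _ ≤ R := by linarith [dist_nonneg (x := x₀) (y := y)]
    refine ⟨hxB, ?_⟩
    have hDx : (R - dist x₀ y) / 2 ≤ R - dist x₀ x := by
      have := dist_triangle x₀ y x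
      rw [dist_comm y x] at this
      linarith
    have hgx : (R - dist x₀ x) ^ 2 * f x ≤ (R - dist x₀ y) ^ 2 * f y := by
      have := hmax hxB
      simpa [hg] using this
    have hfx : 0 ≤ f x := hf0 x hxB
    rcases hDy0.lt_or_eq with hpos | hzero
    · have h2 : ((R - dist x₀ y) / 2) ^ 2 * f x ≤ (R - dist x₀ x) ^ 2 * f x :=
        mul_le_mul_of_nonneg_right (pow_le_pow_left₀ (by linarith) hDx 2) hfx
      have h3 : ((R - dist x₀ y) / 2) ^ 2 * f x ≤ (R - dist x₀ y) ^ 2 * f y := h2.trans hgx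
      have h4 : (R - dist x₀ y) ^ 2 * f x ≤ (R - dist x₀ y) ^ 2 * (4 * f y) := by nlinarith
      exact le_of_mul_le_mul_left h4 (pow_pos hpos 2)
    · -- degenerate case: `y` on the sphere `dist x₀ y = R`; then `x = y`
      have hxy0 : dist x y ≤ 0 := by rw [← hzero] at hxy; simpa using hxy
      have : x = y := dist_le_zero.1 hxy0
      subst this
      linarith

/-- **The blow-up sequence of Lemma 1.5 (Anderson 2000, (1.19)–(1.21)).** Let `f ≥ 0` be
continuous on a metric space with compact closed unit balls (Anderson: `f = |r|` on the complete
orbit space `(S, g_S)`), and let `xᵢ` be a sequence with `f(xᵢ) → ∞` ((1.19)). Selecting `yᵢ` in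
`B̄_{xᵢ}(1)` by `exists_point_selection` gives: `f(yᵢ) → ∞` ("in particular `|r|(yᵢ) → ∞`");
`(1 − dist(xᵢ,yᵢ))² f(yᵢ) → ∞` ((1.20)); after the rescaling `gᵢ = f(yᵢ) · g` (so that
`|rᵢ|(yᵢ) = 1`) the rescaled radius `√(f(yᵢ)) · (1 − dist(xᵢ,yᵢ))/2` of the ball about `yᵢ`
on which the maximality bound holds tends to `∞` ("`δᵢ(yᵢ) → ∞`", scale invariance of (1.20));
and on that ball `f ≤ 4 f(yᵢ)`, i.e. `|rᵢ| ≤ 4` for the rescaled metric ((1.21) ff.: "`|rᵢ|(x) ≤ 2`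
at all points of uniformly bounded `gᵢ`-distance to `yᵢ`", here with the constant `4` on the
half-radius ball). The convergence/collapse alternative that follows (Lemmas 1.3–1.4) is not
formalised. [cite: Anderson2000, Lemma 1.5, (1.19)–(1.21)] -/
theorem exists_blowup_points {X : Type*} [MetricSpace X]
    (hc : ∀ x : X, IsCompact (closedBall x 1)) {f : X → ℝ} (hf : Continuous f)
    (hf0 : ∀ x, 0 ≤ f x) {x : ℕ → X} (hx : Tendsto (fun i ↦ f (x i)) atTop atTop) :
    ∃ y : ℕ → X, (∀ i, dist (x i) (y i) ≤ 1) ∧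
      Tendsto (fun i ↦ f (y i)) atTop atTop ∧
      Tendsto (fun i ↦ (1 - dist (x i) (y i)) ^ 2 * f (y i)) atTop atTop ∧
      Tendsto (fun i ↦ Real.sqrt (f (y i)) * ((1 - dist (x i) (y i)) / 2)) atTop atTop ∧
      ∀ i z, dist z (y i) ≤ (1 - dist (x i) (y i)) / 2 → f z ≤ 4 * f (y i) := by
  have H : ∀ i, ∃ y ∈ closedBall (x i) 1, f (x i) ≤ f y ∧
      (1 : ℝ) ^ 2 * f (x i) ≤ (1 - dist (x i) y) ^ 2 * f y ∧
      ∀ z, dist z y ≤ (1 - dist (x i) y) / 2 → z ∈ closedBall (x i) 1 ∧ f z ≤ 4 * f y := fun i ↦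
    exists_point_selection one_pos (hc (x i)) hf.continuousOn fun z _ ↦ hf0 z
  choose y hyB hfy hgy hloc using H
  have hdist : ∀ i, dist (x i) (y i) ≤ 1 := fun i ↦ by
    have := hyB i; rwa [mem_closedBall, dist_comm] at this
  have h2 : Tendsto (fun i ↦ f (y i)) atTop atTop := tendsto_atTop_mono hfy hx
  have h3 : Tendsto (fun i ↦ (1 - dist (x i) (y i)) ^ 2 * f (y i)) atTop atTop :=
    tendsto_atTop_mono (fun i ↦ by simpa using hgy i) hx
  refine ⟨y, hdist, h2, h3, ?_, fun i z hz ↦ (hloc i z hz).2⟩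
  have h4 : Tendsto (fun i ↦ Real.sqrt ((1 - dist (x i) (y i)) ^ 2 * f (y i)) / 2) atTop atTop :=
    (Real.tendsto_sqrt_atTop.comp h3).atTop_div_const (by norm_num)
  refine h4.congr fun i ↦ ?_
  have hD : 0 ≤ 1 - dist (x i) (y i) := sub_nonneg.2 (hdist i)
  rw [Real.sqrt_mul (sq_nonneg _), Real.sqrt_sq hD]
  ring

end PointSelection

/-! ### §0: the stationary set-up in the tree's vocabulary, and the duplicate named fact -/

section Setup

-- `Manifold` must be rooted: inside `Literature.Geometry.…` a bare `open Manifold` opens the tree's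
-- namespace `Literature.Geometry.Manifold` (CONVENTIONS §2)
open scoped _root_.Manifold _root_.ContDiff

universe u

/-- **The two vendorings of Anderson's Thm. 0.1 coincide.** `Anderson2000_stationaryVacuum_flat`
(`StationaryVacuumRigidity.lean`, cite item wi-20398) and `Anderson2000_completeStationaryVacuumFlat`
(`CompleteStationaryVacuumFlat.lean`, landed later the same day for another route) are the same
proposition, verbatim up to the name of the bound Killing field; recorded by `Iff.rfl` so that a
discharge of either named fact discharges both. [cite: Anderson2000, Thm. 0.1] -/
theorem stationaryVacuum_flat_iff_completeStationaryVacuumFlat :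
    Anderson2000_stationaryVacuum_flat.{u} ↔ Anderson2000_completeStationaryVacuumFlat.{u} :=
  Iff.rfl

variable {𝓢 : Spacetime.{u} 4} {X₀ : Π x : 𝓢.carrier, TangentSpace (𝓡 4) x}

/-- The velocity of an integral curve of `X₀` is `X₀` along the curve ("the infinitesimal generator
of `G ≈ ℝ` is a time-like Killing vector field `X`", Anderson §0; Mathlib's `IsMIntegralCurve`
unfolded through the tree's `velocity`). [cite: Anderson2000, §0] -/
theorem velocity_of_isMIntegralCurve {γ : ℝ → 𝓢.carrier} (hγ : IsMIntegralCurve γ X₀) (t : ℝ) :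
    velocity (𝓡 4) γ t = X₀ (γ t) := by
  rw [velocity, (hγ t).mfderiv]
  change ((1 : ℝ →L[ℝ] ℝ) (1 : ℝ)) • X₀ (γ t) = X₀ (γ t)
  simp

variable [𝓢.metric.HasLeviCivita]

/-- **The orbits are time-like curves** (Anderson §0: "a smooth 1-parameter group `G ≈ ℝ` of
isometries whose orbits are time-like curves"): under `𝓢.IsStationaryKilling X₀ univ` every
integral curve of `X₀` is a future-directed timelike curve on every parameter set.
[cite: Anderson2000, §0] -/
theorem isFutureTimelikeCurveOn_of_isMIntegralCurve (hX : 𝓢.IsStationaryKilling X₀ Set.univ)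
    {γ : ℝ → 𝓢.carrier} (hγ : IsMIntegralCurve γ X₀) (s : Set ℝ) :
    𝓢.metric.IsFutureTimelikeCurveOn 𝓢.timeOrientation γ s := fun t _ ↦ by
  refine ⟨(hγ t).mdifferentiableAt, ?_, ?_⟩
  · rw [velocity_of_isMIntegralCurve hγ t]
    exact (hX.isTimelike (Set.mem_univ _)).1
  · rw [velocity_of_isMIntegralCurve hγ t]
    exact (hX.isTimelike (Set.mem_univ _)).2

/-- **Chronology makes the orbits lines** (Anderson §0–§1.1: the space-time is assumed
chronological, so that `G ≈ ℝ` acts with orbit space a principal `ℝ`-bundle; the elementary part: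
a Killing orbit returning to a point would be a closed timelike curve). Every integral curve of the
stationary Killing field of a chronological spacetime is injective. [cite: Anderson2000, §0 and §1.1] -/
theorem injective_of_isMIntegralCurve (hX : 𝓢.IsStationaryKilling X₀ Set.univ)
    (hchr : 𝓢.metric.IsChronological 𝓢.timeOrientation)
    {γ : ℝ → 𝓢.carrier} (hγ : IsMIntegralCurve γ X₀) : Function.Injective γ := by
  intro s t hst
  by_contra hne
  rcases lt_or_gt_of_ne hne with h | h
  · exact hchr γ s t h (isFutureTimelikeCurveOn_of_isMIntegralCurve hX hγ _) hst
  · exact hchr γ t s h (isFutureTimelikeCurveOn_of_isMIntegralCurve hX hγ _) hst.symm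

/-- **The group `G ≈ ℝ` (Anderson §0), as far as the tree reaches.** The complete smooth Killing
field `X₀` of a stationary spacetime generates a smooth global flow `θ : ℝ × M → M`
(`Literature.Geometry.Manifold.exists_contMDiff_globalFlow_of_complete`, Lee 2012 Thm. 9.12):
`θ(0, p) = p`, `θ(t, θ(s, p)) = θ(t + s, p)`, the curves `t ↦ θ(t, p)` are the integral curves of
`X₀`, hence future-directed timelike, and — the spacetime being chronological — injective, i.e.
the `ℝ`-action is free with orbits diffeomorphic images of `ℝ`. Not formalised: `θ_t` are
isometries (`X₀` Killing), the action is proper and the orbit space `S` is a smooth Hausdorff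
`3`-manifold with `π : M → S` a principal `ℝ`-bundle and `g_M = −u²(dt + θ)² + π*g_S`
(Anderson §0, §1.1, citing [Ha]). [cite: Anderson2000, §0 and §1.1] -/
theorem exists_free_globalFlow (hX : 𝓢.IsStationaryKilling X₀ Set.univ)
    (hchr : 𝓢.metric.IsChronological 𝓢.timeOrientation) :
    ∃ θ : ℝ × 𝓢.carrier → 𝓢.carrier, ContMDiff (𝓘(ℝ, ℝ).prod (𝓡 4)) (𝓡 4) ∞ θ ∧
      (∀ p, θ (0, p) = p) ∧ (∀ t s p, θ (t, θ (s, p)) = θ (t + s, p)) ∧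
      (∀ p, IsMIntegralCurve (fun t ↦ θ (t, p)) X₀) ∧
      (∀ p (s : Set ℝ),
        𝓢.metric.IsFutureTimelikeCurveOn 𝓢.timeOrientation (fun t ↦ θ (t, p)) s) ∧
      ∀ p, Function.Injective fun t ↦ θ (t, p) := by
  have hV : ContMDiff (𝓡 4) (𝓡 4).tangent (⊤ : ℕ∞)
      (fun x ↦ (⟨x, X₀ x⟩ : TangentBundle (𝓡 4) 𝓢.carrier)) := hX.isKillingField.contMDiff
  have hc : ∀ x : 𝓢.carrier, ∃ γ : ℝ → 𝓢.carrier, γ 0 = x ∧ IsMIntegralCurve γ X₀ := fun x ↦ by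
    obtain ⟨γ, hγ, h0⟩ := hX.isCompleteVectorField x
    exact ⟨γ, h0, hγ⟩
  obtain ⟨θ, hθ, h0, hgrp, hint⟩ :=
    Literature.Geometry.Manifold.exists_contMDiff_globalFlow_of_complete hV
      (by exact_mod_cast le_top) hc
  exact ⟨θ, hθ, h0, hgrp, hint,
    fun p s ↦ isFutureTimelikeCurveOn_of_isMIntegralCurve hX (hint p) s,
    fun p ↦ injective_of_isMIntegralCurve hX hchr (hint p)⟩

end Setup

end Anderson2000

end Literature.Geometry.Lorentzian

end
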